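import Summits.Ventures.HodgeRepro.Night1ProductWeilHodge

/-!
# The Weil classes are exceptional on the kernel: unless two corners are complementary (conjugate), the
Weil space of a corner product meets the subalgebra generated by divisor classes only in `0`

Blind re-derivation cell `pub-hodge-repro`, seat `night-1` (gen 5).  Imports night-1's
`Night1ProductWeilHodge` (the Weil space `weilSpaceProd`, the dual functionals `lineDual` and
`exists_lineDual_ne_zero`) and, through it, typer-2's `jointEigenspaceOn` / `balancedWedgesOn` /
`jointEigenspaceOn_eq_span` (the joint eigenspaces are spanned by the balanced coordinate wedges).

S4 (`route/ROUTE.md` §1) is about the Weil classes precisely because they are NOT generated by divisors: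
the Hodge ring of a CM abelian variety is generated by divisor classes unless «exceptional» classes occur
(ROUTE.md §3.0 / S2: the known regime is the divisor-generated one), and the split-Weil corner products
are the first place where exceptional classes appear.  This file records that fact on the kernel:

* `divisorSpace Ψ` — the joint `(1, 1)`-eigenspace of the family of cocharacters (the complexified divisor
  classes, typer-2's dictionary at `p = 1`) read inside the exterior algebra, and **`divisorPower Ψ k`** —
  its `k`-th power in the exterior algebra (the span of the `k`-fold products of divisor classes; Mathlib's
  `Submodule.pow`), pulled back to `⋀^{2k}` as `divisorPowerIn Ψ k`;
* `concatPairs` / `prod_ofFn_coordWedgeOn` — a product of `k` coordinate 2-wedges is the coordinate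
  `2k`-wedge of the concatenated family (Mathlib's `ExteriorAlgebra.ιMulti_mul_ιMulti`), and
  `divisorPower_eq_span` — the `k`-th power is the span of the products of `k` balanced 2-wedges;
* `lineDual_coordWedgeOn_eq_zero_of_notMem_range` — the dual functional of the `σ`-line kills every
  coordinate wedge missing a point of the line (a zero row in the pairing matrix);
* `eq_compl_of_balanced_pair_on_line` — a balanced pair lying on the `σ`-line `{(i, σ), (j, σ)}` forces
  `T j = (T i)ᶜ` (the corners `i`, `j` are complementary — conjugate for CM types);
* **`lineDual_eq_zero_of_mem_divisorPowerIn`** — if no two corners are complementary, every line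
  functional vanishes on the `k`-fold products of divisor classes: a product of `k` balanced pairs pairing
  non-trivially with the `σ`-line would cover the line, so one of its pairs would lie on it;
* **`weilSpaceProd_inf_divisorPowerIn_eq_bot`** — hence `W ⊓ D^k = 0` (`k ≥ 1`): NO nonzero element of the
  Weil space is a polynomial in divisor classes — every nonzero Weil class is exceptional;
* the faces: `faceCorners_ne_compl` — no two corners of a rank-four face `(Φ; p, p')` are complementary
  when `|G| > 4` (in degree 4 the corners `1`, `2` ARE complementary: the face degenerates), hence
  **`face_weilSpaceProd_inf_divisorPowerIn_eq_bot`** — the Weil classes of every rank-four face of a CM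
  type of degree `≥ 6` are exceptional on the kernel (the sealed census is in degrees 6, 8, 12).

Reading (not a claim about varieties): with `H¹(B, ℚ) = K^ι` and typer-2's dictionary «Hodge class = joint
eigenvector of the conjugate cocharacters» (paper-level, NIGHT1.md §12), `divisorPower` is `D^k(B) ⊗ ℂ`,
the degree-`2k` part of the subalgebra of `H^*(B, ℂ)` generated by the divisor classes, and the theorem
says `W_K(B) ∩ D^k(B) = 0` for every corner product without a conjugate pair of corners — the Weil classes
S4 asks about are exactly the classes the Lefschetz `(1, 1)` theorem does not reach.  Nothing geometric
is built; every statement is about coordinate wedges on the finite `G`-set `ι × G`.  Nothing here says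
anything about the status of the Hodge conjecture for CM abelian varieties, which is NOT proved.
-/

set_option autoImplicit false

open Finset Module
open scoped Pointwise

namespace HodgeRepro.RouteC

open CMHodgeOn

/-! ### The divisor-generated part of the exterior algebra -/

section DivisorAlgebra

variable {X : Type*} [Fintype X] [DecidableEq X] {Γ : Type*}

/-- The divisor classes of a family of cocharacters, read in the exterior algebra: the image of the joint
`(1, 1)`-eigenspace `jointEigenspaceOn Ψ 2 1` (typer-2's dictionary for the rational `(1, 1)`-classes of
`⋀^2`, spanned by the balanced 2-wedges) under `⋀^2 ↪ ⋀`. -/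
noncomputable def divisorSpace (Ψ : Γ → Finset X) : Submodule ℂ (ExteriorAlgebra ℂ (X → ℂ)) :=
  (jointEigenspaceOn Ψ (2 * 1) 1).map (⋀[ℂ]^(2 * 1) (X → ℂ)).subtype

/-- **The `k`-fold products of divisor classes**: the `k`-th power of `divisorSpace Ψ` in the exterior
algebra (the degree-`2k` part of the subalgebra generated by the divisor classes). -/
noncomputable def divisorPower (Ψ : Γ → Finset X) (k : ℕ) : Submodule ℂ (ExteriorAlgebra ℂ (X → ℂ)) :=
  divisorSpace Ψ ^ k

/-- The `k`-fold products of divisor classes, as a subspace of `⋀^{2k}`. -/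
noncomputable def divisorPowerIn (Ψ : Γ → Finset X) (k : ℕ) : Submodule ℂ (⋀[ℂ]^(2 * k) (X → ℂ)) :=
  (divisorPower Ψ k).comap (⋀[ℂ]^(2 * k) (X → ℂ)).subtype

omit [Fintype X] in
/-- Membership in `divisorPowerIn`. -/
theorem mem_divisorPowerIn_iff (Ψ : Γ → Finset X) (k : ℕ) (ω : ⋀[ℂ]^(2 * k) (X → ℂ)) :
    ω ∈ divisorPowerIn Ψ k ↔ (ω : ExteriorAlgebra ℂ (X → ℂ)) ∈ divisorPower Ψ k := Iff.rfl

/-- The balanced 2-wedges of `Ψ`, read in the exterior algebra. -/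
def balancedTwoWedges (Ψ : Γ → Finset X) : Set (ExteriorAlgebra ℂ (X → ℂ)) :=
  (⋀[ℂ]^(2 * 1) (X → ℂ)).subtype '' balancedWedgesOn Ψ 1

/-- The divisor space is the span of the balanced 2-wedges (typer-2's `jointEigenspaceOn_eq_span`). -/
theorem divisorSpace_eq_span (Ψ : Γ → Finset X) :
    divisorSpace Ψ = Submodule.span ℂ (balancedTwoWedges Ψ) := by
  rw [divisorSpace, jointEigenspaceOn_eq_span, Submodule.map_span]
  rfl

/-- **The `k`-fold products of divisor classes are spanned by the products of `k` balanced 2-wedges.** -/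
theorem divisorPower_eq_span (Ψ : Γ → Finset X) (k : ℕ) :
    divisorPower Ψ k = Submodule.span ℂ (balancedTwoWedges Ψ ^ k) := by
  rw [divisorPower, divisorSpace_eq_span, Submodule.span_pow]

end DivisorAlgebra

/-! ### Products of coordinate 2-wedges are coordinate `2k`-wedges -/

section Concat

variable {X : Type*} [DecidableEq X]

/-- The concatenation of `k` pairs into one family of `2k` points (the last pair at the end). -/
def concatPairs : {k : ℕ} → (Fin k → Fin 2 → X) → Fin (2 * k) → X
  | 0, _ => Fin.elim0
  | k + 1, s => Fin.append (concatPairs fun j => s j.castSucc) (s (Fin.last k))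

omit [DecidableEq X] in
/-- A point is in the range of the concatenation iff it is in one of the pairs. -/
theorem mem_range_concatPairs {k : ℕ} (s : Fin k → Fin 2 → X) (x : X) :
    x ∈ Set.range (concatPairs s) ↔ ∃ j b, s j b = x := by
  induction k generalizing x with
  | zero =>
    constructor
    · rintro ⟨a, _⟩
      exact a.elim0
    · rintro ⟨j, _, _⟩
      exact j.elim0
  | succ k ih =>
    constructor
    · rintro ⟨a, rfl⟩
      refine Fin.addCases (fun i => ?_) (fun i => ?_) a
      · obtain ⟨j, b, h⟩ := (ih _ _).1 ⟨i, rfl⟩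
        exact ⟨j.castSucc, b, by simpa [concatPairs, Fin.append_left] using h⟩
      · exact ⟨Fin.last k, i, by simp [concatPairs, Fin.append_right]⟩
    · rintro ⟨j, b, rfl⟩
      induction j using Fin.lastCases with
      | last => exact ⟨Fin.natAdd (2 * k) b, by simp [concatPairs, Fin.append_right]⟩
      | cast j =>
        obtain ⟨a, ha⟩ := (ih (fun j => s j.castSucc) (s j.castSucc b)).2 ⟨j, b, rfl⟩
        exact ⟨Fin.castAdd 2 a, by simpa [concatPairs, Fin.append_left] using ha⟩

/-- **A product of `k` coordinate 2-wedges is the coordinate `2k`-wedge of the concatenation**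
(`ExteriorAlgebra.ιMulti_mul_ιMulti`). -/
theorem prod_ofFn_coordWedgeOn {k : ℕ} (s : Fin k → Fin 2 → X) :
    (List.ofFn fun j => (coordWedgeOn 2 (s j) : ExteriorAlgebra ℂ (X → ℂ))).prod =
      (coordWedgeOn (2 * k) (concatPairs s) : ExteriorAlgebra ℂ (X → ℂ)) := by
  induction k with
  | zero =>
    rw [List.ofFn_zero, List.prod_nil, coordWedgeOn, exteriorPower.ιMulti_apply_coe]
    exact (ExteriorAlgebra.ιMulti_zero_apply _).symm
  | succ k ih =>
    rw [List.ofFn_succ', List.prod_concat, ih]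
    simp only [coordWedgeOn, exteriorPower.ιMulti_apply_coe]
    rw [ExteriorAlgebra.ιMulti_mul_ιMulti]
    congr 1
    funext a
    refine Fin.addCases (fun i => ?_) (fun i => ?_) a
    · simp [concatPairs, Fin.append_left]
    · simp [concatPairs, Fin.append_right]

end Concat

/-! ### The line functionals on products of divisor classes -/

section Lines

variable {G : Type*} [Group G] [DecidableEq G] [Fintype G] {ι : Type*} [Fintype ι] [DecidableEq ι]

omit [Group G] [Fintype G] [Fintype ι] in
/-- The dual functional of the `σ`-line kills every coordinate wedge that misses a point of the line
(a zero row in the pairing matrix). -/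
theorem lineDual_coordWedgeOn_eq_zero_of_notMem_range {k : ℕ} (e : Fin (2 * k) ≃ ι) (σ : G)
    {t : Fin (2 * k) → ι × G} {a : Fin (2 * k)} (ha : (e a, σ) ∉ Set.range t) :
    lineDual e σ (coordWedgeOn (2 * k) t) = 0 := by
  unfold lineDual coordWedgeOn
  rw [exteriorPower.pairingDual_ιMulti_ιMulti]
  refine Matrix.det_eq_zero_of_column_eq_zero a fun j => ?_
  rw [Matrix.of_apply, LinearMap.proj_apply, coordVecOn_apply, if_neg]
  intro hEq
  exact ha ⟨j, hEq.symm⟩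

omit [Group G] [Fintype G] [Fintype ι] in
/-- If the dual functional of the `σ`-line does not vanish on a coordinate wedge, the wedge covers the
line: every point `(i, σ)` is in its range. -/
theorem mem_range_of_lineDual_ne_zero {k : ℕ} (e : Fin (2 * k) ≃ ι) (σ : G)
    {t : Fin (2 * k) → ι × G} (h : lineDual e σ (coordWedgeOn (2 * k) t) ≠ 0) (i : ι) :
    (i, σ) ∈ Set.range t := by
  by_contra hi
  apply h
  refine lineDual_coordWedgeOn_eq_zero_of_notMem_range e σ (a := e.symm i) ?_
  rwa [Equiv.apply_symm_apply]

omit [Group G] [Fintype G] in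
/-- A family of `2k` points covering the `σ`-line takes all its values on the line (`|line σ| = 2k`). -/
theorem snd_eq_of_forall_mem_range {k : ℕ} (e : Fin (2 * k) ≃ ι) (σ : G) {t : Fin (2 * k) → ι × G}
    (h : ∀ i : ι, (i, σ) ∈ Set.range t) (a : Fin (2 * k)) : (t a).2 = σ := by
  have hsub : lineSet (ι := ι) σ ⊆ univ.image t := by
    intro q hq
    rw [mem_lineSet] at hq
    obtain ⟨b, hb⟩ := h q.1
    rw [mem_image]
    exact ⟨b, mem_univ b, by rw [hb, ← hq]⟩
  have hcard : (univ.image t).card ≤ (lineSet (ι := ι) σ).card := by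
    rw [card_lineSet, ← Fintype.card_congr e, Fintype.card_fin]
    exact card_image_le.trans (by rw [card_univ, Fintype.card_fin])
  have heq : univ.image t = lineSet (ι := ι) σ := (eq_of_subset_of_card_le hsub hcard).symm
  have hmem : t a ∈ lineSet (ι := ι) σ := by
    rw [← heq]
    exact mem_image_of_mem t (mem_univ a)
  exact (mem_lineSet).1 hmem

/-- For an injective pair `s`, `|{s 0, s 1} ∩ Φ| = 1` iff exactly one of the two points lies in `Φ`. -/
theorem card_image_pair_inter_eq_one_iff {Y : Type*} [DecidableEq Y] {s : Fin 2 → Y}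
    (hs : Function.Injective s) (Φ : Finset Y) :
    (univ.image s ∩ Φ).card = 1 ↔ (s 0 ∈ Φ ↔ s 1 ∉ Φ) := by
  rw [← cornerCountOn_eq_card_inter Φ hs, cornerCountOn, Finset.card_filter, Fin.sum_univ_two]
  by_cases h0 : s 0 ∈ Φ <;> by_cases h1 : s 1 ∈ Φ <;> simp [h0, h1]

/-- **A balanced pair on the `σ`-line forces complementary corners**: if `{(i, σ), (j, σ)}` is a balanced
pair of the conjugate product types (exactly one of its points in `prodTypeSet (g • T)` for every `g`),
then `T j = (T i)ᶜ`. -/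
theorem eq_compl_of_balanced_pair_on_line (T : ι → Finset G) (σ : G) {s : Fin 2 → ι × G}
    (hs : Function.Injective s)
    (hbal : ∀ g : G, (univ.image s ∩ prodTypeSet fun i => g • T i).card = 1)
    (hσ : ∀ b, (s b).2 = σ) : T (s 1).1 = (T (s 0).1)ᶜ := by
  ext τ
  have h := (card_image_pair_inter_eq_one_iff hs _).1 (hbal (σ * τ⁻¹))
  have key : ∀ b, s b ∈ (prodTypeSet fun i => (σ * τ⁻¹) • T i) ↔ τ ∈ T (s b).1 := by
    intro b
    simp only [prodTypeSet, mem_filter, mem_univ, true_and, hσ b]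
    rw [← Finset.inv_smul_mem_iff, smul_eq_mul, mul_inv_rev, inv_inv, inv_mul_cancel_right]
  rw [key, key] at h
  rw [mem_compl]
  tauto

end Lines

/-! ### The Weil space meets the divisor-generated part trivially -/

section Exceptional

variable {G : Type*} [Group G] [DecidableEq G] [Fintype G] {ι : Type*} [Fintype ι] [DecidableEq ι]

/-- **The line functionals vanish on the `k`-fold products of divisor classes** (`k ≥ 1`) when no two
corners are complementary: a product of `k` balanced pairs with `⟨e^*_σ, ·⟩ ≠ 0` would cover the
`σ`-line, so its first pair would lie on the line and force two complementary corners. -/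
theorem lineDual_eq_zero_of_mem_divisorPowerIn {k : ℕ} (hk : 0 < k) (e : Fin (2 * k) ≃ ι)
    (T : ι → Finset G) (hnc : ∀ i j, T j ≠ (T i)ᶜ) (σ : G) {ω : ⋀[ℂ]^(2 * k) ((ι × G) → ℂ)}
    (hω : ω ∈ divisorPowerIn (fun g : G => prodTypeSet fun i => g • T i) k) :
    lineDual e σ ω = 0 := by
  rw [mem_divisorPowerIn_iff, divisorPower_eq_span] at hω
  have hP : ∃ ω' : ⋀[ℂ]^(2 * k) ((ι × G) → ℂ),
      (ω' : ExteriorAlgebra ℂ ((ι × G) → ℂ)) = (ω : ExteriorAlgebra ℂ ((ι × G) → ℂ)) ∧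
        lineDual e σ ω' = 0 := by
    refine Submodule.span_induction (p := fun x _ => ∃ ω' : ⋀[ℂ]^(2 * k) ((ι × G) → ℂ),
      (ω' : ExteriorAlgebra ℂ ((ι × G) → ℂ)) = x ∧ lineDual e σ ω' = 0) ?_ ?_ ?_ ?_ hω
    · intro x hx
      obtain ⟨f, hf⟩ := Set.mem_pow.1 hx
      -- each factor is a balanced 2-wedge
      have hf' : ∀ j : Fin k, ∃ s : Fin 2 → ι × G, Function.Injective s ∧
          (∀ g : G, (univ.image s ∩ prodTypeSet fun i => g • T i).card = 1) ∧
            (coordWedgeOn 2 s : ExteriorAlgebra ℂ ((ι × G) → ℂ)) = (f j : ExteriorAlgebra ℂ ((ι × G) → ℂ)) := by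
        intro j
        obtain ⟨ω₂, ⟨s, hs, hbal, hω₂⟩, hx₂⟩ := (f j).2
        exact ⟨s, hs, hbal, by rw [← hx₂, ← hω₂]; rfl⟩
      choose s hs hbal hfs using hf'
      refine ⟨coordWedgeOn (2 * k) (concatPairs s), ?_, ?_⟩
      · rw [← hf, ← prod_ofFn_coordWedgeOn]
        congr 2
        funext j
        exact hfs j
      · by_contra hne
        have hcover := mem_range_of_lineDual_ne_zero e σ hne
        have hline := snd_eq_of_forall_mem_range e σ hcover
        have h0 : ∀ b, (s ⟨0, hk⟩ b).2 = σ := by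
          intro b
          obtain ⟨a, ha⟩ := (mem_range_concatPairs s _).2 ⟨⟨0, hk⟩, b, rfl⟩
          rw [← ha]
          exact hline a
        exact hnc (s ⟨0, hk⟩ 0).1 (s ⟨0, hk⟩ 1).1
          (eq_compl_of_balanced_pair_on_line T σ (hs ⟨0, hk⟩) (hbal ⟨0, hk⟩) h0)
    · exact ⟨0, by simp, map_zero _⟩
    · rintro x y _ _ ⟨ω₁, h₁, h₁'⟩ ⟨ω₂, h₂, h₂'⟩
      exact ⟨ω₁ + ω₂, by simp [h₁, h₂], by rw [map_add, h₁', h₂', add_zero]⟩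
    · rintro a x _ ⟨ω₁, h₁, h₁'⟩
      exact ⟨a • ω₁, by simp [h₁], by rw [map_smul, h₁', smul_zero]⟩
  obtain ⟨ω', h₁, h₂⟩ := hP
  rw [← Subtype.ext h₁]
  exact h₂

/-- **THE WEIL CLASSES ARE EXCEPTIONAL** (`k ≥ 1`): if no two corners of the family are complementary,
the Weil space meets the `k`-fold products of divisor classes only in `0` — no nonzero element of the Weil
space is a polynomial in divisor classes. -/
theorem weilSpaceProd_inf_divisorPowerIn_eq_bot {k : ℕ} (hk : 0 < k) (e : Fin (2 * k) ≃ ι)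
    (T : ι → Finset G) (hnc : ∀ i j, T j ≠ (T i)ᶜ) :
    weilSpaceProd G k e ⊓ divisorPowerIn (fun g : G => prodTypeSet fun i => g • T i) k = ⊥ := by
  rw [Submodule.eq_bot_iff]
  rintro ω ⟨hω, hD⟩
  by_contra h0
  obtain ⟨σ, hσ⟩ := exists_lineDual_ne_zero hk e hω h0
  exact hσ (lineDual_eq_zero_of_mem_divisorPowerIn hk e T hnc σ hD)

open scoped Classical in
/-- The rational form: no nonzero rational Weil class of a Galois CM field is a polynomial in divisor
classes, when no two corners are complementary (`k ≥ 1`). -/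
theorem ratWeil_notMem_divisorPowerIn (K : Type*) [Field K] [NumberField K] [IsGalois ℚ K]
    (φ₀ : K →+* ℂ) {k : ℕ} (hk : 0 < k) (e : Fin (2 * k) ≃ ι) (T : ι → Finset (K ≃ₐ[ℚ] K))
    (hnc : ∀ i j, T j ≠ (T i)ᶜ) {f : K} (hf : f ≠ 0) :
    ratWeil K φ₀ e f ∉ divisorPowerIn (fun g : K ≃ₐ[ℚ] K => prodTypeSet fun i => g • T i) k := by
  intro hD
  have h := weilSpaceProd_inf_divisorPowerIn_eq_bot hk e T hnc
  rw [Submodule.eq_bot_iff] at h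
  exact ratWeil_ne_zero K φ₀ hk e hf (h _ ⟨ratWeil_mem_weilSpaceProd K φ₀ e f, hD⟩)

end Exceptional

/-! ### The rank-four faces: no two corners complementary (degree `≥ 6`) -/

section Faces

variable {G : Type*} [Group G] [DecidableEq G] [Fintype G]

/-- When `|G| > 4` there is an embedding outside two given places. -/
theorem exists_notMem_place_union (c p p' : G) (h4 : 4 < Fintype.card G) :
    ∃ x : G, x ∉ place c p ∧ x ∉ place c p' := by
  have hcard : (place c p ∪ place c p').card < (univ : Finset G).card := by
    rw [card_univ]
    refine lt_of_le_of_lt (card_union_le _ _) ?_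
    have h1 : (place c p).card ≤ 2 := card_le_two
    have h2 : (place c p').card ≤ 2 := card_le_two
    omega
  obtain ⟨x, _, hx⟩ := exists_mem_notMem_of_card_lt_card hcard
  rw [mem_union] at hx
  exact ⟨x, fun h => hx (Or.inl h), fun h => hx (Or.inr h)⟩

-- The 16 corner pairs are dispatched by one of three witnesses with one simp set; the unused-argument
-- linter is silenced for this proof only (each witness uses a different part of the set).
set_option linter.unusedSimpArgs false in
/-- **No two corners of a rank-four face are complementary** when `[F : ℚ] = |G| > 4` (for `|G| = 4` the
corners `1` and `2` are complementary: the face degenerates).  Witnesses: `p` or `p'` for the pairs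
involving one flip, an embedding outside both places for the pairs `(0, 3)` and `(1, 2)`. -/
theorem faceCorners_ne_compl {c : G} (hc : IsComplexConj c) {Φ : Finset G} (hΦ : IsCMType c Φ)
    {p p' : G} (hπ : p' ∉ place c p) (h4 : 4 < Fintype.card G) (i j : Fin 4) :
    faceCorners c Φ p p' j ≠ (faceCorners c Φ p p' i)ᶜ := by
  have hp : p ∉ place c p' := by
    intro h
    exact Finset.disjoint_left.1 (disjoint_place hc hπ) (mem_place_self c p) h
  have hp0 : p ∈ place c p := mem_place_self c p
  have hp0' : p' ∈ place c p' := mem_place_self c p'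
  obtain ⟨x, hx, hx'⟩ := exists_notMem_place_union c p p' h4
  intro h
  have hext := Finset.ext_iff.1 h
  fin_cases i <;> fin_cases j <;> simp only [faceCorners] at hext
  all_goals first
    | simpa [mem_flipAt, hΦ.smul_eq_compl hc, hp0, hp, hp0', hπ, hx, hx'] using hext p
    | simpa [mem_flipAt, hΦ.smul_eq_compl hc, hp0, hp, hp0', hπ, hx, hx'] using hext p'
    | simpa [mem_flipAt, hΦ.smul_eq_compl hc, hp0, hp, hp0', hπ, hx, hx'] using hext x

/-- **The Weil classes of every rank-four face are exceptional on the kernel** (`|G| > 4`): on the full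
four-corner product `Fin 4 × G` the Weil space meets the products of two divisor classes only in `0`. -/
theorem face_weilSpaceProd_inf_divisorPowerIn_eq_bot {c : G} (hc : IsComplexConj c) {Φ : Finset G}
    (hΦ : IsCMType c Φ) {p p' : G} (hπ : p' ∉ place c p) (h4 : 4 < Fintype.card G) :
    weilSpaceProd G 2 (Equiv.refl (Fin (2 * 2))) ⊓
      divisorPowerIn (fun g : G => prodTypeSet fun i => g • faceCorners c Φ p p' i) 2 = ⊥ :=
  weilSpaceProd_inf_divisorPowerIn_eq_bot (by norm_num) _ _ (faceCorners_ne_compl hc hΦ hπ h4)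

end Faces

end HodgeRepro.RouteC
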